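import Literature.AlgebraicGeometry.Resolution.DifferentialOperators
import Mathlib.Data.Nat.Multiplicity
import Mathlib.Data.Nat.Choose.Sum
import Mathlib.Algebra.CharP.Defs
import HarnessLib

/-!
# Differential operators of order `< p^N` are linear over `p^N`-th powers (characteristic `p`)

Topic `Literature/AlgebraicGeometry/Resolution`, companion of `DifferentialOperators.lean` (EGA IV₄ §16.8
differential operators of order `≤ n` of an `R`-algebra `A`, predicate `IsDiffOpLE R n D` defined by iterated
commutators `[D, a]`, 16.8.8 (b)). This file proves the classical characteristic-`p` fact

  `D ∈ Diff^{≤ n}_{A/R}`, `(p : A) = 0`, `n < p^N`  ⟹  `D (f^{p^N} · g) = f^{p^N} · D g` for all `f, g ∈ A`,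

i.e. every differential operator of order `< p^N` is linear over the `p^N`-th powers (`ρ^N(A)`, `ρ` = Frobenius)
— C. Abad, J. Algebra 523 (2019), Lemma 6.2 (case `M = A`), attributed there to J. Giraud (1972); see References.
Proof (elementary, kernel-checked below): on the `R`-module `E = End_R(A)` the two
endomorphisms `λ_f : D ↦ f̂ ∘ D` and `ad_f : D ↦ [D, f] = D ∘ f̂ − f̂ ∘ D` (`f̂` = multiplication by `f`) commute and
`D ↦ D ∘ f̂` is their sum; the binomial theorem for commuting elements gives
`D ∘ f̂^q = ∑_k (q choose k) · f̂^{q−k} ∘ ad_f^k(D)`; for `q = p^N` the binomial coefficients with `0 < k < q` are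
divisible by `p` and vanish on `E`, the term `k = q` vanishes because `ad_f^{n+1}(D) = 0` for `D` of order `≤ n`
(the definition of the order), and the term `k = 0` is `f̂^q ∘ D`.

Bearing (index only, nothing from it is used or asserted): H. Hironaka, *Resolution of singularities in positive
characteristics* (ms. 2017), Def. 3.2 p.8 «any `∂ ∈ Diff_Z` is `ρ^N(O)`-linear for all large enough `N` depending
upon `∂`» and Cor. 7.15 p.40 (campaign res-hironaka, LADDER-RESOLUTION rung M: the typed candidates
`Hironaka2017.S03DiffARNE` row 022 / `Hironaka2017.S07Permissible.Cor7_15_ours` consume exactly this property as a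
hypothesis or reading). The present file is tree library over `Resolution.IsDiffOpLE`, not a statement of that
manuscript.

## Contents

* `mulLeftPost R f`, `adMul R f` — the `R`-linear endomorphisms `D ↦ f̂ ∘ D` and `D ↦ [D, f]` of `A →ₗ[R] A`;
  `preMul_eq` : `D ∘ f̂ = (mulLeftPost R f + adMul R f) D`; `commute_mulLeftPost_adMul`.
* `IsDiffOpLE.adMul_pow_apply_eq_zero` — `D` of order `≤ n` ⟹ `ad_f^k(D) = 0` for `n < k`.
* `IsDiffOpLE.comp_mulLeft_pow_char_pow` — `D ∘ f̂^{p^N} = f̂^{p^N} ∘ D` for `n < p^N`, `(p : A) = 0`.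
* `IsDiffOpLE.apply_pow_char_pow_mul` — `D (f^{p^N} g) = f^{p^N} D g` (the headline);
  `IsDiffOpLE.commMul_pow_char_pow` — `[D, f^{p^N}] = 0`.

## References

* C. Abad, *p-Bases and differential operators on varieties defined over a non-perfect field*, J. Algebra 523
  (2019) 217–240 = arXiv:1801.08458 (held: lit key `paper:arxiv-1801.08458`), §6 **Lemma 6.2** (read on p0013 of
  the held text): «Let `k` be a ring of characteristic `p > 0`, let `A` be an arbitrary `k`-algebra, and let `M` be
  an `A`-module. If `Δ : A → M` is a differential operator of order `n` over `k`, then `Δ` is `k[A^{p^e}]`-linear for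
  every `p^e > n`.» — with Definition 6.1 there = the commutator recursion of EGA IV₄ 16.8.8 (b), i.e. exactly the
  tree's `IsDiffOpLE` (for `M = A`); Abad attributes the lemma to Giraud, *Étude locale des singularités* (Orsay
  1972). This file PROVES the case `M = A` on the generators `f^{p^e}` of `k[A^{p^e}]`. [Abad2019pBases]
* A. Grothendieck, J. Dieudonné, ÉGA IV₄, Publ. Math. IHÉS 32 (1967), §16.8 (Déf. 16.8.1, Prop. 16.8.8). [EGAIV4]
-/

namespace Literature.AlgebraicGeometry.Resolution

open Finset

section FrobeniusLinear

variable (R : Type*) {A : Type*} [CommSemiring R] [CommRing A] [Algebra R A]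

/-- Post-composition with the multiplication by `f`: the `R`-linear endomorphism `D ↦ f̂ ∘ D` of `A →ₗ[R] A`
(`(f̂ ∘ D) t = f · D t`). [folklore] -/
def mulLeftPost (f : A) : (A →ₗ[R] A) →ₗ[R] (A →ₗ[R] A) where
  toFun D := LinearMap.mulLeft R f ∘ₗ D
  map_add' _ _ := LinearMap.comp_add _ _ _
  map_smul' _ _ := LinearMap.comp_smul _ _ _

/-- The commutator with the multiplication by `f` as an `R`-linear endomorphism of `A →ₗ[R] A`:
`adMul R f D = commMul R D f = D ∘ f̂ − f̂ ∘ D` (EGA's `D_f`, 16.8.8.1). [cite: EGAIV4, Prop. 16.8.8 (16.8.8.1)] -/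
def adMul (f : A) : (A →ₗ[R] A) →ₗ[R] (A →ₗ[R] A) where
  toFun D := commMul R D f
  map_add' D E := commMul_add_left R D E f
  map_smul' r D := by
    ext t
    simp only [commMul_apply, LinearMap.smul_apply, RingHom.id_apply, smul_sub, mul_smul_comm]

/-- `mulLeftPost R f D = f̂ ∘ D` (plumbing). [folklore] -/
@[simp] private theorem mulLeftPost_apply (f : A) (D : A →ₗ[R] A) :
    mulLeftPost R f D = LinearMap.mulLeft R f ∘ₗ D := rfl

/-- `adMul R f D = [D, f]` (plumbing). [cite: EGAIV4, Prop. 16.8.8 (16.8.8.1)] -/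
@[simp] private theorem adMul_apply (f : A) (D : A →ₗ[R] A) : adMul R f D = commMul R D f := rfl

/-- `D ∘ f̂ = f̂ ∘ D + [D, f]`: pre-composition with `f̂` is the sum of `mulLeftPost` and `adMul` (private helper).
[folklore] -/
private theorem preMul_eq (f : A) (D : A →ₗ[R] A) :
    D ∘ₗ LinearMap.mulLeft R f = (mulLeftPost R f + adMul R f) D := by
  rw [LinearMap.add_apply, mulLeftPost_apply, adMul_apply, commMul]
  abel

/-- `λ_f` and `ad_f` commute (both are built from composition with `f̂` on one side; private helper). [folklore] -/
private theorem commute_mulLeftPost_adMul (f : A) :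
    Commute (mulLeftPost R f : Module.End R (A →ₗ[R] A)) (adMul R f) := by
  refine LinearMap.ext fun D => ?_
  rw [Module.End.mul_apply, Module.End.mul_apply, mulLeftPost_apply, adMul_apply, adMul_apply,
    mulLeftPost_apply, commMul, commMul, LinearMap.comp_sub, LinearMap.comp_assoc]

/-- Powers of `λ_f`: `λ_f^k(D) = f̂^k ∘ D`, with `f̂^k` = multiplication by `f^k` (private helper). [folklore] -/
private theorem mulLeftPost_pow_apply (f : A) (k : ℕ) (D : A →ₗ[R] A) :
    ((mulLeftPost R f) ^ k) D = LinearMap.mulLeft R (f ^ k) ∘ₗ D := by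
  induction k with
  | zero =>
    rw [pow_zero, pow_zero, Module.End.one_apply, LinearMap.mulLeft_one, LinearMap.id_comp]
  | succ k ih =>
    rw [pow_succ', Module.End.mul_apply, ih, mulLeftPost_apply, ← LinearMap.comp_assoc,
      ← LinearMap.mulLeft_mul, ← pow_succ']

/-- Powers of pre-composition: `(λ_f + ad_f)^k(D) = D ∘ f̂^k` (private helper). [folklore] -/
private theorem mulLeftPost_add_adMul_pow_apply (f : A) (k : ℕ) (D : A →ₗ[R] A) :
    ((mulLeftPost R f + adMul R f) ^ k) D = D ∘ₗ LinearMap.mulLeft R (f ^ k) := by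
  induction k generalizing D with
  | zero => rw [pow_zero, pow_zero, Module.End.one_apply, LinearMap.mulLeft_one, LinearMap.comp_id]
  | succ k ih =>
    rw [pow_succ, Module.End.mul_apply, ← preMul_eq, ih, LinearMap.comp_assoc, ← LinearMap.mulLeft_mul,
      ← pow_succ']

variable {R}

/-- **The order drops under `ad`**: if `D` has order `≤ n` then `ad_f^k(D) = 0` for every `k > n` (the defining
property of the order, EGA IV₄ 16.8.8 (b)/(c), iterated with one fixed `f`). [cite: EGAIV4, Prop. 16.8.8] -/
theorem IsDiffOpLE.adMul_pow_apply_eq_zero (f : A) :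
    ∀ {n : ℕ} {D : A →ₗ[R] A}, IsDiffOpLE R n D → ∀ {k : ℕ}, n < k → ((adMul R f) ^ k) D = 0
  | 0, D, hD, k, hk => by
    obtain ⟨k, rfl⟩ := Nat.exists_eq_add_of_lt hk
    rw [zero_add, pow_succ, Module.End.mul_apply, adMul_apply, hD f, map_zero]
  | n + 1, D, hD, k, hk => by
    obtain ⟨k, rfl⟩ := Nat.exists_eq_add_of_lt hk
    rw [pow_succ, Module.End.mul_apply, adMul_apply]
    exact IsDiffOpLE.adMul_pow_apply_eq_zero f (hD f) (by omega)

/-- In characteristic `p` the binomial coefficients `(p^N choose k)`, `0 < k < p^N`, kill every `R`-linear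
endomorphism of `A`: `(p^N choose k) • D = 0` (private helper; `p ∣ (p^N choose k)` is Mathlib's
`Nat.Prime.dvd_choose_pow`). [folklore] -/
private theorem choose_char_pow_smul_eq_zero {p : ℕ} (hp : p.Prime) (hA : (p : A) = 0) {N k : ℕ} (hk0 : k ≠ 0)
    (hk : k ≠ p ^ N) (D : A →ₗ[R] A) : ((p ^ N).choose k) • D = 0 := by
  obtain ⟨c, hc⟩ := hp.dvd_choose_pow hk0 hk
  ext t
  rw [LinearMap.smul_apply, LinearMap.zero_apply, hc, mul_smul, nsmul_eq_mul, hA, zero_mul]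

/-- **`D ∘ f̂^{p^N} = f̂^{p^N} ∘ D`** for `D` of order `≤ n < p^N` in characteristic `p` (`(p : A) = 0`): the
binomial expansion of `(λ_f + ad_f)^{p^N}` applied to `D` has only the term `λ_f^{p^N}(D)` left — the middle
coefficients are multiples of `p`, the top `ad`-power kills `D`. Operator form of Abad's Lemma 6.2 (= Giraud 1972)
for `M = A` and the generator `f^{p^N}`. [cite: Abad2019pBases, Lemma 6.2] -/
theorem IsDiffOpLE.comp_mulLeft_pow_char_pow {p : ℕ} (hp : p.Prime) (hA : (p : A) = 0) {n : ℕ}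
    {D : A →ₗ[R] A} (hD : IsDiffOpLE R n D) {N : ℕ} (hn : n < p ^ N) (f : A) :
    D ∘ₗ LinearMap.mulLeft R (f ^ p ^ N) = LinearMap.mulLeft R (f ^ p ^ N) ∘ₗ D := by
  rw [← mulLeftPost_add_adMul_pow_apply R f (p ^ N) D, (commute_mulLeftPost_adMul R f).add_pow,
    LinearMap.sum_apply, Finset.sum_range_succ, Finset.sum_eq_zero, zero_add,
    Nat.choose_self, Nat.cast_one, mul_one, Nat.sub_self, pow_zero, mul_one, mulLeftPost_pow_apply]
  intro k hk
  rw [Finset.mem_range] at hk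
  rw [Module.End.mul_apply, Module.End.mul_apply, Module.End.natCast_apply]
  by_cases hk0 : k = 0
  · subst hk0
    rw [Nat.choose_zero_right, one_nsmul, Nat.sub_zero, hD.adMul_pow_apply_eq_zero f hn, map_zero]
  · rw [choose_char_pow_smul_eq_zero hp hA hk0 (Nat.ne_of_lt hk) D, map_zero, map_zero]

/-- **Differential operators of order `< p^N` are `p^N`-th-power linear**: for `D ∈ Diff^{≤ n}_{A/R}`,
`(p : A) = 0` and `n < p^N`, `D (f^{p^N} · g) = f^{p^N} · D g` for all `f, g ∈ A` — `D` is linear over the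
`p^N`-th powers (`ρ^N(A)`, `ρ` = Frobenius; with `R`-linearity: over `R[A^{p^N}]`). This is Abad 2019, Lemma 6.2
(«If `Δ : A → M` is a differential operator of order `n` over `k`, then `Δ` is `k[A^{p^e}]`-linear for every
`p^e > n`», attributed there to Giraud 1972) for `M = A`, proved here from the tree's definition `IsDiffOpLE`
(= Abad's Def. 6.1 = EGA IV₄ 16.8.8 (b)). [cite: Abad2019pBases, Lemma 6.2] -/
theorem IsDiffOpLE.apply_pow_char_pow_mul {p : ℕ} (hp : p.Prime) (hA : (p : A) = 0) {n : ℕ}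
    {D : A →ₗ[R] A} (hD : IsDiffOpLE R n D) {N : ℕ} (hn : n < p ^ N) (f g : A) :
    D (f ^ p ^ N * g) = f ^ p ^ N * D g := by
  have h := congrArg (fun L : A →ₗ[R] A => L g) (hD.comp_mulLeft_pow_char_pow hp hA hn f)
  simpa only [LinearMap.comp_apply, LinearMap.mulLeft_apply] using h

/-- The same, as the vanishing of the commutator `[D, f^{p^N}] = 0` (Abad 2019 Lemma 6.2 for `M = A`, commutator form).
[cite: Abad2019pBases, Lemma 6.2] -/
theorem IsDiffOpLE.commMul_pow_char_pow {p : ℕ} (hp : p.Prime) (hA : (p : A) = 0) {n : ℕ}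
    {D : A →ₗ[R] A} (hD : IsDiffOpLE R n D) {N : ℕ} (hn : n < p ^ N) (f : A) :
    commMul R D (f ^ p ^ N) = 0 := by
  rw [commMul, hD.comp_mulLeft_pow_char_pow hp hA hn f, sub_self]

/-- `CharP` form of the headline (Abad 2019 Lemma 6.2 for `M = A`): in a ring `A` of characteristic `p`, an operator
of order `≤ n < p^N` is `ρ^N(A)`-linear. [cite: Abad2019pBases, Lemma 6.2] -/
theorem IsDiffOpLE.apply_pow_char_pow_mul' (p : ℕ) [Fact p.Prime] [CharP A p] {n : ℕ}
    {D : A →ₗ[R] A} (hD : IsDiffOpLE R n D) {N : ℕ} (hn : n < p ^ N) (f g : A) :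
    D (f ^ p ^ N * g) = f ^ p ^ N * D g :=
  hD.apply_pow_char_pow_mul (Fact.out : p.Prime) (CharP.cast_eq_zero A p) hn f g

end FrobeniusLinear

end Literature.AlgebraicGeometry.Resolution
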